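import Literature.NumberTheory.GaloisRepresentations.LocalGaloisGroupInertiaProofs
import Literature.NumberTheory.GaloisRepresentations.AbsGaloisGroupProofs
import HarnessLib

/-!
# `I_E = res⁻¹(I_F)`: the inertia group of a finite extension is the preimage of the inertia group

Topic `NumberTheory/GaloisRepresentations`; namespace `Literature.NumberTheory.GaloisRepresentations`.
Theorems only (no definition, no named fact).  For non-archimedean local fields `F`, `E` and an
`F`-algebra structure on `E` with `E/F` algebraic, the restriction
`res = absGaloisRestrict F E : Γ_E = Gal(Ē/E) → Γ_F = Gal(F̄/F)` (along the chosen `ι : F̄ ≅ Ē`,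
bijective since `E/F` is algebraic, `absClosureEquiv`) satisfies

* `comap_absInertia_absGaloisRestrict_le` — `res⁻¹(I_F) ≤ I_E` (the converse of the tree's
  `absInertia_map_absGaloisRestrict_le_holds : res(I_E) ≤ I_F`): if `res σ` is trivial on the residue
  field of `S_F` then `σ` is trivial on the residue field of `S_E = ι(S_F)`
  (`absClosureEmbedding_mem_absIntegers_iff`, `absClosureEmbedding_mem_absMaximalIdeal_iff`,
  `ι (res σ • a) = σ • ι a`);
* **`absInertia_eq_comap_absGaloisRestrict` — `I_E = res⁻¹(I_F)`**, and the membership form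
  `mem_absInertia_iff_absGaloisRestrict_mem : σ ∈ I_E ↔ res σ ∈ I_F`
  (Serre, *Local Fields* I §7 Prop. 22 a): `T(L/E) = T(L/K) ∩ G(L/E)`; Tate, Corvallis (1.4.5):
  `W_E = G_E ∩ W_F` on inertia).

Honest framing: classical; nothing here bears on abc or takes a side on [IUTchIII] Cor. 3.12.

## References
* J.-P. Serre, *Local Fields* (1979), Ch. I §7 Prop. 22. [SerreLocalFields1979]
* J. Tate, *Number theoretic background*, Corvallis 1979, §1.4 (1.4.5). [Corvallis1979]
-/

noncomputable section

open Function
open Field IsNonarchimedeanLocalField ValuativeRel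

namespace Literature.NumberTheory.GaloisRepresentations

open GaloisRepresentations.IsNonarchimedeanLocalField

section InertiaComap

variable (F E : Type*) [Field F] [ValuativeRel F] [TopologicalSpace F]
  [IsNonarchimedeanLocalField F] [Field E] [ValuativeRel E] [TopologicalSpace E]
  [IsNonarchimedeanLocalField E] [Algebra F E] [Algebra.IsAlgebraic F E]

/-- **`res⁻¹(I_F) ≤ I_E`**: an element of `Γ_E` whose restriction to `F̄` lies in the inertia group
of `F` lies in the inertia group of `E` (`E/F` algebraic, so `ι : F̄ → Ē` is onto and identifies
integers and primes). [cite: SerreLocalFields1979, Ch. I §7 Prop. 22 a)] -/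
theorem comap_absInertia_absGaloisRestrict_le :
    (absInertia F).comap (absGaloisRestrict F E).toMonoidHom ≤ absInertia E := by
  haveI : ValuativeExtension F E :=
    valuativeExtension_of_cast_residueFieldCard_eq_zero cast_residueFieldCard_eq_zero_of_algebra
  intro σ hσ
  rw [Subgroup.mem_comap, mem_absInertia_iff] at hσ
  rw [mem_absInertia_iff]
  intro y
  set ι := absClosureEmbedding F E with hι
  -- `y = ι a` with `a ∈ S_F`
  set a : AlgebraicClosure F := (absClosureEquiv F E).symm (y : AlgebraicClosure E) with ha
  have hιa : ι a = y := (absClosureEquiv F E).apply_symm_apply (y : AlgebraicClosure E)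
  have haS : a ∈ absIntegers 𝒪[F] F :=
    (absClosureEmbedding_mem_absIntegers_iff a).mp (by rw [← hι, hιa]; exact y.2)
  set z : absIntegers 𝒪[F] F :=
    (absGaloisRestrict F E).toMonoidHom σ • (⟨a, haS⟩ : absIntegers 𝒪[F] F) - ⟨a, haS⟩ with hz_def
  have hz : z ∈ absMaximalIdeal F := hσ ⟨a, haS⟩
  have hzE : ι z ∈ absIntegers 𝒪[E] E := (absClosureEmbedding_mem_absIntegers_iff _).mpr z.2
  have key : (⟨ι z, hzE⟩ : absIntegers 𝒪[E] E) ∈ absMaximalIdeal E :=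
    (absClosureEmbedding_mem_absMaximalIdeal_iff z hzE).mpr hz
  convert key using 1
  apply Subtype.ext
  change ((σ • y : absIntegers 𝒪[E] E) : AlgebraicClosure E) - y =
    ι ((((absGaloisRestrict F E σ • (⟨a, haS⟩ : absIntegers 𝒪[F] F) : absIntegers 𝒪[F] F)) :
      AlgebraicClosure F) - a)
  rw [map_sub, integralClosure.coe_smul, integralClosure.coe_smul, absGaloisRestrict_apply_smul, hιa]

/-- **`I_E = res⁻¹(I_F)`**: the inertia group of `E` is the preimage of the inertia group of `F`
under the restriction `Γ_E → Γ_F` (`E/F` algebraic).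
[cite: SerreLocalFields1979, Ch. I §7 Prop. 22 a)] -/
theorem absInertia_eq_comap_absGaloisRestrict :
    absInertia E = (absInertia F).comap (absGaloisRestrict F E).toMonoidHom :=
  le_antisymm (Subgroup.map_le_iff_le_comap.mp (absInertia_map_absGaloisRestrict_le_holds F E))
    (comap_absInertia_absGaloisRestrict_le F E)

variable {E} in
/-- `σ ∈ I_E ↔ res σ ∈ I_F` (`E/F` algebraic). [cite: SerreLocalFields1979, Ch. I §7 Prop. 22 a)] -/
theorem mem_absInertia_iff_absGaloisRestrict_mem (σ : absoluteGaloisGroup E) :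
    σ ∈ absInertia E ↔ absGaloisRestrict F E σ ∈ absInertia F := by
  rw [absInertia_eq_comap_absGaloisRestrict F E, Subgroup.mem_comap]
  rfl

end InertiaComap

end Literature.NumberTheory.GaloisRepresentations

end
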